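import Summits.QuantumFields.YangMills.Theorems.UnitScaleTiltProp7TorusGreenConvolutionRows
import Summits.QuantumFields.YangMills.Theorems.UnitScaleTiltProp7TransplantFlatBiharmonic
import Summits.QuantumFields.YangMills.Theorems.UnitScaleTiltProp7GreenKernelSiteFreeLaplace
import Summits.QuantumFields.YangMills.Theorems.UnitScaleTiltProp7TransplantDipolePotential
import Summits.QuantumFields.YangMills.Theorems.LangevinControlUVFemtoCurvatureTwoPointStubFieldStrengthCovariance
import HarnessLib

/-!
# Route `UnitScaleTilt`, crux K1 «MinimiserStabilityRegPr» (stmt-QuantumFields-19200), route-R E′ path (α′), (E1-b) at the CURVED background, (A-cov) gen-1, FILE B «F₀ ROWS»: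
# THE FLAT BIHARMONIC POTENTIAL `F₀ := Σ_y G y ·•J y` OF THE gen-1 DENSITY `J` (`‖J y‖ ≤ D∕(1∨tdist(y,b))²` in the ball `tdist(·,b) ≤ 9n`), over the RE-BASED free site kernel
# `G y z := Gf y z − Gf c₁ z` (`c₁` a near centre, `tdist(c₁,b) ≤ 9n`; px4 ✓`exists_green_site_split_free` at `c = 1`, routeR-w6 g6 ✓`bilaplace_green_rebase`): the exact bi-Laplacian
# `Δ₁²(G y) = δ_y − δ_c`, the SPLIT `Δ₁F₀ = P₁ − M₁` (`P₁ := Σ_y ½G̃₁(EK y − EK ·)•J y` the `J`-half with `Δ₁P₁ = J − L_T^{−d}•ΣJ`, `M₁ := ½G̃₁(EK · − EK c)•ΣJ` the monopole)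
# and the POINTWISE ROWS the gen-1 numbers read — (F0-0) `‖F₀ z‖ ≤ C·ΣJ·(1 + 9n + tdist(z,b))`, (F0-1) `‖F₀(z ± e_μ) − F₀ z‖ ≤ C·ΣJ` (all `z`), (P1-0) `‖P₁ z‖ ≤ C·D·√(135n∕(1∨tdist(z,b)))`,
# (P1-1) `‖P₁(z ± e_μ) − P₁ z‖ ≤ C·D∕(1∨tdist(z,b))` (`tdist(z,b) ≤ 88n`), (M1-0) `‖M₁ z‖ ≤ C·ΣJ∕(1∨tdist(z,c))`, with `ΣJ := Σ_y‖J y‖ ≤ D·(8 + 1728n)` — ONE absolute `C` (`P.d = 3`), NO `log`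

Cell `ym3-torus`, extra width seat `ym-routeR-w6` (gen 7); LOCATE-GEN1 v1.0 §2 (19200 evidence #41).  Inputs BY NAME: ★w8 ✓p674845 `Prop7TorusGreenKernelRows` (K-1) `abs_green_EK_le`,
(K-3) `abs_green2_grad_EK_le`, (K-6) `abs_green2_sub_zero_EK_le`; ★w8 ✓p675215 `Prop7TorusGreenConvolutionRows.conv_green_le` (the LOG-FREE `a = 1` form of ★routeR-w3 g6's engine) and `conv_green_grad_le`;
✓`FemtoCurvatureTwoPoint.torusGreen_neg` (evenness, to turn `G̃₁(EK z − EK y)` summed over `y` into the engine's `G̃₁(EK y − EK z)`); ✓`Prop7TorusGreenConvolution.sum_inv_max_sq_le` (`ΣJ`).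
THEOREMS ONLY (0 `def`, 0 `sorry`); `--supports stmt-QuantumFields-19200`, count-neutral.  YM₃ on T³ is a ladder rung (R3), not the Clay problem; nothing here claims a stub, the crux, d = 4 or the mass gap.

WHAT IS PROVED (ns `…Theorems.Prop7TransplantGen1F0Rows`; `Site P 0`, `P.d = 3`, `k ≤ m+K`, pole `b`, near centre `c₁`, scale `n ≥ 1`; `V` a real normed space; `laplace 1` = the flat Laplacian).
* §1 letters: ★ `sum_norm_le_of_density` (`Σ_y‖J y‖ ≤ D(8 + 192·9n)`), `norm_sum_smul_le_of_pointwise`, `tdist_le_add_of_ball`, `inv_max_le_two_mul`.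
* §2 rows for an ABSTRACT kernel with the displayed formulas `G y z = ¼(G₂(EK z − EK y) − G₂(EK z − EK c))`, `Δ₁(G y) z = ½(G̃₁(EK z − EK y) − G̃₁(EK z − EK c))` and displayed
  kernel∕convolution constants: `norm_potential_le` (F0-0), `norm_potential_diff_le` (F0-1), ★ `laplace_potential_eq_P1_sub_M1` (`Δ₁F₀ = P₁ − M₁`), `norm_P1_le` (P1-0), `norm_P1_diff_le` (P1-1),
  `norm_M1_le` (M1-0), ★ `laplace_P1_eq` (`Δ₁P₁ = J − L_T^{−d}•ΣJ`, px4 ✓`laplace_one_torusGreen_EK_sub`).  The monopole `M₁` is exported UNDIFFERENTIATED (px11 g4 (D2): its gradient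
  against the pole-anchored cone `t₁` would cost `ℓ^{1∕2}` too much in the site channel; it rides the type-1 channel `c₁′` instead).
* §3 ★★★ `exists_F0_rows` — `∃ C ≥ 0` absolute, `∀ P (d = 3) k b c n J D (rows)`, `∃ G`, `Δ₁²(G y) = δ_y − δ_c` ∧ (G-1) `Δ₁(G y) z = ½(G̃₁(EK z − EK y) − G̃₁(EK z − EK c))` ∧ `ΣJ` ∧ (F0-0) ∧ (F0-1) ∧ split ∧ (P1-Δ) ∧ (P1-0) ∧ (P1-1) ∧ (M1-0).
HONEST SCOPE.  Counting over landed kernel rows; the cutoff, the fields `F F′ c₁′ c₂′` and the covariant numbers are FILE C.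

References: T. Bałaban, CMP 95 (1984) 17–40 [Balaban1984PropagatorsI] (Sect. C p.22, (1.17)–(1.21) pp.20–21); CMP 99 (1985) 389–434 [Balaban1985BackgroundPropagators] ((3.8) p.392);
G. F. Lawler, V. Limic, *Random Walk: A Modern Introduction*, CUP 2010, Thm 4.3.1 [LawlerLimic2010].
-/

set_option autoImplicit false

noncomputable section

open scoped BigOperators
open Finset
namespace Summit.QuantumFields.YangMills.Theorems.Prop7TransplantGen1F0Rows

open Literature.MathematicalPhysics.QuantumFieldTheory.Balaban1983to89
open LatticeFieldCalculus (laplace)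
open B5Prop11Plancherel (Tor fine unitVec)
open B5Eq117TorusCarriers (Mk EK EK_apply)
open Literature.Probability.LatticeModels (torusGreen TorusSite latticeMomentum dispersion)
open B3Taylor310LocalRemainder (tdist_comm tdist_self tdist_triangle)
open Prop7PinnedKernelGeometry (tdist_shift_le_add_one tdist_le_tdist_shift_add_one tdist_unshift_le_add_one tdist_le_tdist_unshift_add_one)
open Prop7TorusGreenKernelRows (abs_green_EK_le abs_green2_grad_EK_le abs_green2_sub_zero_EK_le)
open Prop7TorusGreenConvolutionRows (conv_green_le conv_green_grad_le)
open Prop7TorusGreenConvolution (sum_inv_max_sq_le norm_sum_smul_le_of_conv)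
open Prop7GreenKernelSiteFree (exists_green_site_split_free)
open Prop7TransplantFlatBiharmonic (laplace_sum_smul bilaplace_green_rebase)
open Prop7TransplantDipolePotential (EK_shift_sub EK_unshift_sub EK_sub_shift_right laplace_one_sub)
open FemtoCurvatureTwoPoint (torusGreen_neg)

variable {P : Params} {k : ℕ}

/-! ## §1 Letters -/

/-- ★ **THE `ℓ¹` MASS OF THE gen-1 DENSITY**: `‖J y‖ ≤ D∕(1∨tdist(y,b))²` in the ball `tdist ≤ 9n`, `0` outside ⇒ `Σ_y‖J y‖ ≤ D·(8 + 192·(9n))` (`d = 3`). [cite: LawlerLimic2010, Thm 4.3.1] -/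
theorem sum_norm_le_of_density {V : Type*} [SeminormedAddCommGroup V] (hd : P.d = 3) (b : Site P 0) (n : ℕ) (J : Site P 0 → V) {D : ℝ} (hD : 0 ≤ D)
    (hJ : ∀ y, ‖J y‖ ≤ D / (max 1 ((Site.tdist y b : ℕ) : ℝ)) ^ 2) (hJ0 : ∀ y, 9 * n < Site.tdist y b → J y = 0) :
    ∑ y, ‖J y‖ ≤ D * (8 + 192 * ((9 * n : ℕ) : ℝ)) := by
  classical
  set S := (univ : Finset (Site P 0)).filter (fun y => Site.tdist y b ≤ 9 * n) with hS
  have hball : ∑ y, ‖J y‖ = ∑ y ∈ S, ‖J y‖ := by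
    symm
    refine Finset.sum_subset (Finset.filter_subset _ _) fun y _ hy => ?_
    rw [Finset.mem_filter, not_and, not_le] at hy
    rw [hJ0 y (hy (Finset.mem_univ _)), norm_zero]
  rw [hball]
  have hmem : ∀ y ∈ S, Site.tdist y b ≤ 9 * n := fun y hy => (Finset.mem_filter.1 hy).2
  calc ∑ y ∈ S, ‖J y‖ ≤ ∑ y ∈ S, D * ((max 1 ((Site.tdist y b : ℕ) : ℝ)) ^ 2)⁻¹ :=
        Finset.sum_le_sum fun y _ => (hJ y).trans (le_of_eq (div_eq_mul_inv _ _))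
    _ = D * ∑ y ∈ S, ((max 1 ((Site.tdist y b : ℕ) : ℝ)) ^ 2)⁻¹ := by rw [Finset.mul_sum]
    _ ≤ D * (8 + 192 * ((9 * n : ℕ) : ℝ)) := mul_le_mul_of_nonneg_left (sum_inv_max_sq_le hd S b (9 * n) hmem) hD

/-- a pointwise kernel bound `|a y| ≤ B` on the support of `J` gives `‖Σ_y a y • J y‖ ≤ B·Σ_y‖J y‖`. [folklore] -/
theorem norm_sum_smul_le_of_pointwise {V : Type*} [SeminormedAddCommGroup V] [NormedSpace ℝ V] (a : Site P 0 → ℝ) (J : Site P 0 → V) {B : ℝ}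
    (h : ∀ y, J y ≠ 0 → |a y| ≤ B) : ‖∑ y, a y • J y‖ ≤ B * ∑ y, ‖J y‖ := by
  refine (norm_sum_smul_le_of_conv a J le_rfl).trans ?_
  rw [Finset.mul_sum]
  refine Finset.sum_le_sum fun y _ => ?_
  by_cases hy : J y = 0
  · rw [hy, norm_zero, mul_zero, mul_zero]
  · exact mul_le_mul_of_nonneg_right (h y hy) (norm_nonneg _)

/-- `tdist(z, y) ≤ tdist(z, b) + 9n` for `y` in the ball `tdist(y,b) ≤ 9n`, in `ℝ`. [folklore] -/
theorem tdist_le_add_of_ball (z y b : Site P 0) {n : ℕ} (hy : Site.tdist y b ≤ 9 * n) :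
    ((Site.tdist z y : ℕ) : ℝ) ≤ (Site.tdist z b : ℝ) + 9 * n := by
  have h := tdist_triangle z b y; rw [tdist_comm b y] at h
  have h' : Site.tdist z y ≤ Site.tdist z b + 9 * n := h.trans (by omega)
  exact_mod_cast h'

/-- `(1 ∨ tdist(z′, c))⁻¹ ≤ 2·(1 ∨ tdist(z, c))⁻¹` whenever `tdist(z, c) ≤ tdist(z′, c) + 1`. [folklore] -/
theorem inv_max_le_two_mul (z z' c : Site P 0) (h : Site.tdist z c ≤ Site.tdist z' c + 1) :
    (max 1 ((Site.tdist z' c : ℕ) : ℝ))⁻¹ ≤ 2 * (max 1 ((Site.tdist z c : ℕ) : ℝ))⁻¹ := by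
  have h1 : (1 : ℝ) ≤ max 1 ((Site.tdist z' c : ℕ) : ℝ) := le_max_left _ _
  have hr : ((Site.tdist z c : ℕ) : ℝ) ≤ (Site.tdist z' c : ℝ) + 1 := by exact_mod_cast h
  have hkey : max 1 ((Site.tdist z c : ℕ) : ℝ) ≤ 2 * max 1 ((Site.tdist z' c : ℕ) : ℝ) :=
    max_le (by linarith) (by linarith [le_max_right (1 : ℝ) ((Site.tdist z' c : ℕ) : ℝ)])
  rw [show (2 : ℝ) * (max 1 ((Site.tdist z c : ℕ) : ℝ))⁻¹ = (max 1 ((Site.tdist z c : ℕ) : ℝ) / 2)⁻¹ by rw [inv_div, div_eq_mul_inv, mul_comm]]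
  exact inv_anti₀ (by positivity) (by linarith)

/-! ## §2 Rows for an abstract kernel with the displayed `G̃₂` ∕ `G̃₁` formulas; the split `Δ₁F₀ = P₁ − M₁` -/

section Rows

variable (hk : k ≤ P.m + P.K) (b c : Site P 0) (n : ℕ) {V : Type*} [NormedAddCommGroup V] [NormedSpace ℝ V] (J : Site P 0 → V)
  (G : Site P 0 → Site P 0 → ℝ)

/-- (F0-0) **SIZE**: `G y z = ¼(G₂(EK z − EK y) − G₂(EK z − EK c))` with (K-6) `|G₂ t − G₂ 0| ≤ c₆(1 + tdist)` and `J` supported in `tdist(·,b) ≤ 9n ∋ c` give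
`‖Σ_y G y z • J y‖ ≤ c₆·SJ·(1 + 9n + tdist(z,b))` (`Σ_y‖J y‖ ≤ SJ`). [cite: Balaban1984PropagatorsI, (1.17) p.20] -/
theorem norm_potential_le (hc : Site.tdist c b ≤ 9 * n) (hJsupp : ∀ y, J y ≠ 0 → Site.tdist y b ≤ 9 * n)
    (G₂ : TorusSite P.d (P.L ^ k * P.sitesPerDir k) → ℝ) (hGval : ∀ y z, G y z = (1 / 4 : ℝ) * (G₂ (EK hk z - EK hk y) - G₂ (EK hk z - EK hk c)))
    {c6 SJ : ℝ} (hc6 : 0 ≤ c6) (hJsum : ∑ y, ‖J y‖ ≤ SJ) (K6 : ∀ x z : Site P 0, |G₂ (EK hk z - EK hk x) - G₂ 0| ≤ c6 * (1 + ((Site.tdist z x : ℕ) : ℝ))) (z : Site P 0) :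
    ‖∑ y, G y z • J y‖ ≤ c6 * SJ * (1 + 9 * n + (Site.tdist z b : ℝ)) := by
  have hfin : c6 * (1 + 9 * n + (Site.tdist z b : ℝ)) * ∑ y, ‖J y‖ ≤ c6 * SJ * (1 + 9 * n + (Site.tdist z b : ℝ)) := by
    rw [mul_assoc, mul_assoc, mul_comm SJ]
    exact mul_le_mul_of_nonneg_left (mul_le_mul_of_nonneg_left hJsum (by positivity)) hc6
  refine (norm_sum_smul_le_of_pointwise (fun y => G y z) J fun y hy => ?_).trans hfin
  have hyb := hJsupp y hy
  show |G y z| ≤ _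
  rw [hGval]
  have e : G₂ (EK hk z - EK hk y) - G₂ (EK hk z - EK hk c) = (G₂ (EK hk z - EK hk y) - G₂ 0) - (G₂ (EK hk z - EK hk c) - G₂ 0) := by ring
  rw [e, abs_mul, abs_of_nonneg (by norm_num : (0 : ℝ) ≤ 1 / 4)]
  have h1 := K6 y z
  have h2 := K6 c z
  have d1 := tdist_le_add_of_ball z y b hyb
  have d2 := tdist_le_add_of_ball z c b hc
  have h3 := abs_sub (G₂ (EK hk z - EK hk y) - G₂ 0) (G₂ (EK hk z - EK hk c) - G₂ 0)
  have h1' : c6 * (1 + ((Site.tdist z y : ℕ) : ℝ)) ≤ c6 * (1 + 9 * n + (Site.tdist z b : ℝ)) := mul_le_mul_of_nonneg_left (by linarith) hc6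
  have h2' : c6 * (1 + ((Site.tdist z c : ℕ) : ℝ)) ≤ c6 * (1 + 9 * n + (Site.tdist z b : ℝ)) := mul_le_mul_of_nonneg_left (by linarith) hc6
  have h0 : 0 ≤ c6 * (1 + 9 * n + (Site.tdist z b : ℝ)) := by positivity
  linarith

/-- (F0-1) **NEIGHBOUR DIFFERENCES, ALL `z`**: with (K-3) `|G₂(t + eᵢ) − G₂ t| ≤ c₃`: `‖Σ_y G y (z ± e_μ) • J y − Σ_y G y z • J y‖ ≤ (c₃∕2)·SJ`. [cite: Balaban1984PropagatorsI, (1.17) p.20] -/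
theorem norm_potential_diff_le (G₂ : TorusSite P.d (P.L ^ k * P.sitesPerDir k) → ℝ) (hGval : ∀ y z, G y z = (1 / 4 : ℝ) * (G₂ (EK hk z - EK hk y) - G₂ (EK hk z - EK hk c)))
    {c3 SJ : ℝ} (hJsum : ∑ y, ‖J y‖ ≤ SJ) (K3 : ∀ (x z : Site P 0) (i : Fin P.d), |G₂ ((EK hk z - EK hk x) + Pi.single i 1) - G₂ (EK hk z - EK hk x)| ≤ c3)
    (z : Site P 0) (μ : Fin P.d) :
    ‖(∑ y, G y (z.shift μ) • J y) - ∑ y, G y z • J y‖ ≤ c3 / 2 * SJ ∧ ‖(∑ y, G y (z.unshift μ) • J y) - ∑ y, G y z • J y‖ ≤ c3 / 2 * SJ := by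
  have hshift : ∀ y, |G y (z.shift μ) - G y z| ≤ c3 / 2 := by
    intro y
    rw [hGval, hGval, EK_shift_sub hk z y μ, EK_shift_sub hk z c μ]
    have h1 := K3 y z μ
    have h2 := K3 c z μ
    rw [abs_le] at h1 h2 ⊢
    constructor <;> linarith
  have hunshift : ∀ y, |G y (z.unshift μ) - G y z| ≤ c3 / 2 := by
    intro y
    rw [hGval, hGval]
    have e1 : EK hk z - EK hk y = (EK hk (z.unshift μ) - EK hk y) + Pi.single μ 1 := by rw [EK_unshift_sub hk z y μ, sub_add_cancel]
    have e2 : EK hk z - EK hk c = (EK hk (z.unshift μ) - EK hk c) + Pi.single μ 1 := by rw [EK_unshift_sub hk z c μ, sub_add_cancel]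
    have h1 := K3 y (z.unshift μ) μ
    have h2 := K3 c (z.unshift μ) μ
    rw [← e1] at h1
    rw [← e2] at h2
    rw [abs_le] at h1 h2 ⊢
    constructor <;> linarith
  have hc3 : 0 ≤ c3 / 2 := by linarith [(abs_nonneg _).trans (hshift c)]
  have key : ∀ z', (∀ y, |G y z' - G y z| ≤ c3 / 2) → ‖(∑ y, G y z' • J y) - ∑ y, G y z • J y‖ ≤ c3 / 2 * SJ := by
    intro z' hz'
    rw [← Finset.sum_sub_distrib]
    simp only [← sub_smul]
    exact (norm_sum_smul_le_of_pointwise (fun y => G y z' - G y z) J fun y _ => hz' y).trans (mul_le_mul_of_nonneg_left hJsum hc3)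
  exact ⟨key _ hshift, key _ hunshift⟩

/-- **THE SPLIT `Δ₁F₀ = P₁ − M₁`**: `Δ₁(G y) z = ½(G̃₁(EK z − EK y) − G̃₁(EK z − EK c))` and evenness of `G̃₁` give
`Δ₁(Σ_y G y ·•J y) z = Σ_y (½G̃₁(EK y − EK z)) • J y − (½G̃₁(EK z − EK c)) • Σ_y J y` (the `J`-half `P₁` in the convolution engine's orientation, the monopole `M₁`). [cite: Balaban1984PropagatorsI, (1.21) p.21] -/
theorem laplace_potential_eq_P1_sub_M1
    (hGlap : ∀ y z, laplace 1 (G y) z = (1 / 2 : ℝ) * (torusGreen (L := P.L ^ k * P.sitesPerDir k) (EK hk z - EK hk y) - torusGreen (L := P.L ^ k * P.sitesPerDir k) (EK hk z - EK hk c)))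
    (z : Site P 0) :
    laplace 1 (fun w => ∑ y, G y w • J y) z
      = (∑ y, ((1 / 2 : ℝ) * torusGreen (L := P.L ^ k * P.sitesPerDir k) (EK hk y - EK hk z)) • J y)
        - ((1 / 2 : ℝ) * torusGreen (L := P.L ^ k * P.sitesPerDir k) (EK hk z - EK hk c)) • ∑ y, J y := by
  rw [laplace_sum_smul, Finset.smul_sum, ← Finset.sum_sub_distrib]
  refine Finset.sum_congr rfl fun y _ => ?_
  rw [hGlap, ← sub_smul, ← neg_sub (EK hk y) (EK hk z), torusGreen_neg]
  congr 1
  ring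

/-- (P1-0) **THE `J`-HALF**: the LOG-FREE convolution row (a = 1) at kernel centre `z` gives `‖P₁ z‖ ≤ ½·Ca·D·√(135n∕(1∨tdist(z,b)))` for `tdist(z,b) ≤ 90n`. [cite: LawlerLimic2010, Thm 4.3.1] -/
theorem norm_P1_le {Ca D : ℝ}
    (CVa : ∀ x : Site P 0, Site.tdist x b ≤ 2 * (45 * n) →
      ∑ y, |torusGreen (L := P.L ^ k * P.sitesPerDir k) (EK hk y - EK hk x)| * ‖J y‖ ≤ Ca * D * Real.sqrt (3 * ((45 * n : ℕ) : ℝ) / max 1 ((Site.tdist x b : ℕ) : ℝ)))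
    (z : Site P 0) (hz : Site.tdist z b ≤ 90 * n) :
    ‖∑ y, ((1 / 2 : ℝ) * torusGreen (L := P.L ^ k * P.sitesPerDir k) (EK hk y - EK hk z)) • J y‖
      ≤ (1 / 2) * Ca * (D * Real.sqrt (3 * ((45 * n : ℕ) : ℝ) / max 1 ((Site.tdist z b : ℕ) : ℝ))) := by
  refine (norm_sum_smul_le_of_conv _ J le_rfl).trans ?_
  have e : ∀ y, |(1 / 2 : ℝ) * torusGreen (L := P.L ^ k * P.sitesPerDir k) (EK hk y - EK hk z)| * ‖J y‖
      = (1 / 2 : ℝ) * (|torusGreen (L := P.L ^ k * P.sitesPerDir k) (EK hk y - EK hk z)| * ‖J y‖) := fun y => by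
    rw [abs_mul, abs_of_nonneg (by norm_num : (0 : ℝ) ≤ 1 / 2), mul_assoc]
  simp only [e]
  rw [← Finset.mul_sum]
  have h := CVa z (by omega)
  linarith

/-- (P1-1) **NEIGHBOUR DIFFERENCES OF THE `J`-HALF** for `tdist(z,b) ≤ 88n`: the gradient convolution row (K-2 ∘ `conv_inv_sq`) at kernel centre `z + e_μ` (resp. `z`):
`‖P₁(z ± e_μ) − P₁ z‖ ≤ Cb·D∕(1∨tdist(z,b))`. [cite: LawlerLimic2010, Thm 4.3.1] -/
theorem norm_P1_diff_le (hn : 1 ≤ n) {Cb D : ℝ} (hCb : 0 ≤ Cb) (hD : 0 ≤ D)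
    (CVb : ∀ (x : Site P 0) (i : Fin P.d), Site.tdist x b ≤ 2 * (45 * n) →
      ∑ y, |torusGreen (L := P.L ^ k * P.sitesPerDir k) ((EK hk y - EK hk x) + Pi.single i 1) - torusGreen (L := P.L ^ k * P.sitesPerDir k) (EK hk y - EK hk x)| * ‖J y‖
        ≤ Cb * D * (max 1 ((Site.tdist x b : ℕ) : ℝ))⁻¹)
    (z : Site P 0) (μ : Fin P.d) (hz : Site.tdist z b ≤ 88 * n) :
    ‖(∑ y, ((1 / 2 : ℝ) * torusGreen (L := P.L ^ k * P.sitesPerDir k) (EK hk y - EK hk (z.shift μ))) • J y)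
        - ∑ y, ((1 / 2 : ℝ) * torusGreen (L := P.L ^ k * P.sitesPerDir k) (EK hk y - EK hk z)) • J y‖ ≤ Cb * (D / max 1 ((Site.tdist z b : ℕ) : ℝ)) ∧
      ‖(∑ y, ((1 / 2 : ℝ) * torusGreen (L := P.L ^ k * P.sitesPerDir k) (EK hk y - EK hk (z.unshift μ))) • J y)
        - ∑ y, ((1 / 2 : ℝ) * torusGreen (L := P.L ^ k * P.sitesPerDir k) (EK hk y - EK hk z)) • J y‖ ≤ Cb * (D / max 1 ((Site.tdist z b : ℕ) : ℝ)) := by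
  have hmb : 0 < max 1 ((Site.tdist z b : ℕ) : ℝ) := lt_of_lt_of_le one_pos (le_max_left _ _)
  -- the common algebra
  have hdiff : ∀ z', (∑ y, ((1 / 2 : ℝ) * torusGreen (L := P.L ^ k * P.sitesPerDir k) (EK hk y - EK hk z')) • J y)
        - ∑ y, ((1 / 2 : ℝ) * torusGreen (L := P.L ^ k * P.sitesPerDir k) (EK hk y - EK hk z)) • J y
      = ∑ y, ((1 / 2 : ℝ) * (torusGreen (L := P.L ^ k * P.sitesPerDir k) (EK hk y - EK hk z') - torusGreen (L := P.L ^ k * P.sitesPerDir k) (EK hk y - EK hk z))) • J y := by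
    intro z'
    rw [← Finset.sum_sub_distrib]
    refine Finset.sum_congr rfl fun y _ => ?_
    rw [← sub_smul, mul_sub]
  have hbound : ∀ z', (∑ y, |torusGreen (L := P.L ^ k * P.sitesPerDir k) (EK hk y - EK hk z') - torusGreen (L := P.L ^ k * P.sitesPerDir k) (EK hk y - EK hk z)| * ‖J y‖
        ≤ Cb * D * (2 * (max 1 ((Site.tdist z b : ℕ) : ℝ))⁻¹)) →
      ‖∑ y, ((1 / 2 : ℝ) * (torusGreen (L := P.L ^ k * P.sitesPerDir k) (EK hk y - EK hk z') - torusGreen (L := P.L ^ k * P.sitesPerDir k) (EK hk y - EK hk z))) • J y‖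
        ≤ Cb * (D / max 1 ((Site.tdist z b : ℕ) : ℝ)) := by
    intro z' h
    refine (norm_sum_smul_le_of_conv _ J le_rfl).trans ?_
    have e : ∀ y, |(1 / 2 : ℝ) * (torusGreen (L := P.L ^ k * P.sitesPerDir k) (EK hk y - EK hk z') - torusGreen (L := P.L ^ k * P.sitesPerDir k) (EK hk y - EK hk z))| * ‖J y‖
        = (1 / 2 : ℝ) * (|torusGreen (L := P.L ^ k * P.sitesPerDir k) (EK hk y - EK hk z') - torusGreen (L := P.L ^ k * P.sitesPerDir k) (EK hk y - EK hk z)| * ‖J y‖) := fun y => by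
      rw [abs_mul, abs_of_nonneg (by norm_num : (0 : ℝ) ≤ 1 / 2), mul_assoc]
    simp only [e]
    rw [← Finset.mul_sum, show Cb * (D / max 1 ((Site.tdist z b : ℕ) : ℝ)) = Cb * D * (max 1 ((Site.tdist z b : ℕ) : ℝ))⁻¹ by rw [div_eq_mul_inv, mul_assoc]]
    linarith
  constructor
  · rw [hdiff]
    refine hbound _ ?_
    have hx : Site.tdist (z.shift μ) b ≤ 2 * (45 * n) := by have := tdist_shift_le_add_one z b μ; omega
    have e : ∀ y, |torusGreen (L := P.L ^ k * P.sitesPerDir k) (EK hk y - EK hk (z.shift μ)) - torusGreen (L := P.L ^ k * P.sitesPerDir k) (EK hk y - EK hk z)|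
        = |torusGreen (L := P.L ^ k * P.sitesPerDir k) ((EK hk y - EK hk (z.shift μ)) + Pi.single μ 1) - torusGreen (L := P.L ^ k * P.sitesPerDir k) (EK hk y - EK hk (z.shift μ))| := by
      intro y
      have e1 : EK hk y - EK hk z = (EK hk y - EK hk (z.shift μ)) + Pi.single μ 1 := by rw [EK_sub_shift_right hk y z μ, sub_add_cancel]
      rw [e1, abs_sub_comm]
    simp only [e]
    have hinv : (max 1 ((Site.tdist (z.shift μ) b : ℕ) : ℝ))⁻¹ ≤ 2 * (max 1 ((Site.tdist z b : ℕ) : ℝ))⁻¹ :=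
      inv_max_le_two_mul z (z.shift μ) b (tdist_le_tdist_shift_add_one z b μ)
    exact (CVb (z.shift μ) μ hx).trans (mul_le_mul_of_nonneg_left hinv (by positivity))
  · rw [hdiff]
    refine hbound _ ?_
    have hx : Site.tdist z b ≤ 2 * (45 * n) := by omega
    have e : ∀ y, |torusGreen (L := P.L ^ k * P.sitesPerDir k) (EK hk y - EK hk (z.unshift μ)) - torusGreen (L := P.L ^ k * P.sitesPerDir k) (EK hk y - EK hk z)|
        = |torusGreen (L := P.L ^ k * P.sitesPerDir k) ((EK hk y - EK hk z) + Pi.single μ 1) - torusGreen (L := P.L ^ k * P.sitesPerDir k) (EK hk y - EK hk z)| := by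
      intro y; rw [Prop7GreenKernelSiteRows.EK_sub_unshift_eq hk y z μ]
    simp only [e]
    have h2 : Cb * D * (max 1 ((Site.tdist z b : ℕ) : ℝ))⁻¹ ≤ Cb * D * (2 * (max 1 ((Site.tdist z b : ℕ) : ℝ))⁻¹) :=
      mul_le_mul_of_nonneg_left (by linarith [inv_pos.2 hmb |>.le]) (by positivity)
    exact (CVb z μ hx).trans h2

/-- (M1-0) **THE MONOPOLE HALF** (re-basing term, UNDIFFERENTIATED — it rides the type-1 channel): (K-1) gives `‖(½G̃₁(EK z − EK c)) • Σ_y J y‖ ≤ ½·c₁·SJ∕(1∨tdist(z,c))`.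
[cite: Balaban1984PropagatorsI, (1.17) p.20] -/
theorem norm_M1_le {c1 SJ : ℝ} (hJsum : ∑ y, ‖J y‖ ≤ SJ)
    (K1 : ∀ x z : Site P 0, |torusGreen (L := P.L ^ k * P.sitesPerDir k) (EK hk z - EK hk x)| ≤ c1 / max 1 ((Site.tdist z x : ℕ) : ℝ)) (z : Site P 0) :
    ‖((1 / 2 : ℝ) * torusGreen (L := P.L ^ k * P.sitesPerDir k) (EK hk z - EK hk c)) • ∑ y, J y‖ ≤ (1 / 2) * c1 * (SJ / max 1 ((Site.tdist z c : ℕ) : ℝ)) := by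
  have hm0 : 0 < max 1 ((Site.tdist z c : ℕ) : ℝ) := lt_of_lt_of_le one_pos (le_max_left _ _)
  have hpole := K1 c z
  have hc1 : 0 ≤ c1 / max 1 ((Site.tdist z c : ℕ) : ℝ) := (abs_nonneg _).trans hpole
  rw [norm_smul, Real.norm_eq_abs, abs_mul, abs_of_nonneg (by norm_num : (0 : ℝ) ≤ 1 / 2)]
  have hQ : ‖∑ y, J y‖ ≤ SJ := (norm_sum_le _ _).trans hJsum
  have a := mul_le_mul hpole hQ (norm_nonneg _) hc1
  have e : c1 / max 1 ((Site.tdist z c : ℕ) : ℝ) * SJ = c1 * (SJ / max 1 ((Site.tdist z c : ℕ) : ℝ)) := by ring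
  rw [e] at a
  linarith

/-- (P1-Δ) **THE `J`-HALF IS A FLAT POTENTIAL OF `J` UP TO THE ZERO MODE**: `Δ₁P₁ x₀ = J x₀ − L_T^{−d}•Σ_y J y` (px4 ✓`laplace_one_torusGreen_EK_sub`). [cite: Balaban1984PropagatorsI, (1.21) p.21] -/
theorem laplace_P1_eq [DecidableEq (Site P 0)] (x₀ : Site P 0) :
    laplace 1 (fun w => ∑ y, ((1 / 2 : ℝ) * torusGreen (L := P.L ^ k * P.sitesPerDir k) (EK hk y - EK hk w)) • J y) x₀
      = J x₀ - ((((P.L ^ k * P.sitesPerDir k : ℕ) : ℝ) ^ P.d)⁻¹) • ∑ y, J y := by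
  rw [laplace_sum_smul 1 (fun y w => (1 / 2 : ℝ) * torusGreen (L := P.L ^ k * P.sitesPerDir k) (EK hk y - EK hk w)) J x₀]
  have e : ∀ y, laplace 1 ((fun y w => (1 / 2 : ℝ) * torusGreen (L := P.L ^ k * P.sitesPerDir k) (EK hk y - EK hk w)) y) x₀
      = (if x₀ = y then (1 : ℝ) else 0) - ((((P.L ^ k * P.sitesPerDir k : ℕ) : ℝ) ^ P.d)⁻¹) := by
    intro y
    show laplace 1 (fun w => (1 / 2 : ℝ) * torusGreen (L := P.L ^ k * P.sitesPerDir k) (EK hk y - EK hk w)) x₀ = _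
    rw [Prop7GreenKernelSiteTransport.laplace_one_const_mul, Prop7GreenKernelSiteFreeLaplace.laplace_one_torusGreen_EK_sub]
    ring
  simp only [e, sub_smul, Finset.sum_sub_distrib, ite_smul, one_smul, zero_smul, Finset.sum_ite_eq, Finset.mem_univ, if_true,
    Finset.smul_sum]

end Rows

/-! ## §3 ★★★ The re-based kernel, `F₀`, the split of `Δ₁F₀`, and all rows with one absolute constant -/

open B15DeterminingSets (embIter) in
/-- ★★★ **THE gen-1 FLAT POTENTIAL `F₀ := Σ_y G y ·•J y` AND ITS ROWS** (see the module docstring): for `d = 3`, a pole `b`, a reference site `c` with `tdist(c,b) ≤ 9n` (`n ≥ 1`; consumers take `c := b`) and a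
`V`-valued density `J` with `‖J y‖ ≤ D∕(1∨tdist(y,b))²`, `J = 0` off `{tdist ≤ 9n}`: the re-based free kernel `G y z := Gf y z − Gf c z` has `Δ₁²(G y) = δ_y − δ_c`; `Δ₁F₀ = P₁ − M₁` with
`P₁ z := Σ_y (½G̃₁(EK y − EK z)) • J y`, `M₁ z := (½G̃₁(EK z − EK c)) • ΣJ`, `Δ₁P₁ = J − L_T^{−d}•ΣJ`; and (F0-0) (F0-1) (P1-0) (P1-1) (M1-0) with ONE absolute `C` and `ΣJ := Σ_y‖J y‖ ≤ D(8 + 192·9n)`.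
[cite: Balaban1984PropagatorsI, Sect. C p.22, (1.17)–(1.21) pp.20–21; Balaban1985BackgroundPropagators, (3.8) p.392; LawlerLimic2010, Thm 4.3.1] -/
theorem exists_F0_rows : ∃ C : ℝ, 0 ≤ C ∧ ∀ (P : Params) (_ : P.d = 3) (k : ℕ) (hk : k ≤ P.m + P.K) (b c : Site P 0) (n : ℕ) (_ : 1 ≤ n)
    (_ : Site.tdist c b ≤ 9 * n) {V : Type*} [NormedAddCommGroup V] [NormedSpace ℝ V] (J : Site P 0 → V) (D : ℝ) (_ : 0 ≤ D)
    (_ : ∀ y, ‖J y‖ ≤ D / (max 1 ((Site.tdist y b : ℕ) : ℝ)) ^ 2) (_ : ∀ y, 9 * n < Site.tdist y b → J y = 0),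
    ∃ G : Site P 0 → Site P 0 → ℝ,
      (∀ y z, laplace 1 (laplace 1 (G y)) z = (if z = y then (1 : ℝ) else 0) - (if z = c then (1 : ℝ) else 0)) ∧
      (∀ y z, laplace 1 (G y) z = (1 / 2 : ℝ) * (torusGreen (L := P.L ^ k * P.sitesPerDir k) (EK hk z - EK hk y)
        - torusGreen (L := P.L ^ k * P.sitesPerDir k) (EK hk z - EK hk c))) ∧
      (∑ y, ‖J y‖ ≤ D * (8 + 192 * ((9 * n : ℕ) : ℝ))) ∧
      (∀ z, ‖∑ y, G y z • J y‖ ≤ C * (D * (8 + 192 * ((9 * n : ℕ) : ℝ))) * (1 + 9 * n + (Site.tdist z b : ℝ))) ∧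
      (∀ z μ, ‖(∑ y, G y (z.shift μ) • J y) - ∑ y, G y z • J y‖ ≤ C * (D * (8 + 192 * ((9 * n : ℕ) : ℝ))) ∧
        ‖(∑ y, G y (z.unshift μ) • J y) - ∑ y, G y z • J y‖ ≤ C * (D * (8 + 192 * ((9 * n : ℕ) : ℝ)))) ∧
      (∀ z, laplace 1 (fun w => ∑ y, G y w • J y) z
          = (∑ y, ((1 / 2 : ℝ) * torusGreen (L := P.L ^ k * P.sitesPerDir k) (EK hk y - EK hk z)) • J y)
            - ((1 / 2 : ℝ) * torusGreen (L := P.L ^ k * P.sitesPerDir k) (EK hk z - EK hk c)) • ∑ y, J y) ∧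
      (∀ z, laplace 1 (fun w => ∑ y, ((1 / 2 : ℝ) * torusGreen (L := P.L ^ k * P.sitesPerDir k) (EK hk y - EK hk w)) • J y) z
          = J z - ((((P.L ^ k * P.sitesPerDir k : ℕ) : ℝ) ^ P.d)⁻¹) • ∑ y, J y) ∧
      (∀ z, Site.tdist z b ≤ 90 * n →
        ‖∑ y, ((1 / 2 : ℝ) * torusGreen (L := P.L ^ k * P.sitesPerDir k) (EK hk y - EK hk z)) • J y‖
          ≤ C * (D * Real.sqrt (3 * ((45 * n : ℕ) : ℝ) / max 1 ((Site.tdist z b : ℕ) : ℝ)))) ∧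
      (∀ z μ, Site.tdist z b ≤ 88 * n →
        ‖(∑ y, ((1 / 2 : ℝ) * torusGreen (L := P.L ^ k * P.sitesPerDir k) (EK hk y - EK hk (z.shift μ))) • J y)
            - ∑ y, ((1 / 2 : ℝ) * torusGreen (L := P.L ^ k * P.sitesPerDir k) (EK hk y - EK hk z)) • J y‖ ≤ C * (D / max 1 ((Site.tdist z b : ℕ) : ℝ)) ∧
        ‖(∑ y, ((1 / 2 : ℝ) * torusGreen (L := P.L ^ k * P.sitesPerDir k) (EK hk y - EK hk (z.unshift μ))) • J y)
            - ∑ y, ((1 / 2 : ℝ) * torusGreen (L := P.L ^ k * P.sitesPerDir k) (EK hk y - EK hk z)) • J y‖ ≤ C * (D / max 1 ((Site.tdist z b : ℕ) : ℝ))) ∧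
      (∀ z, ‖((1 / 2 : ℝ) * torusGreen (L := P.L ^ k * P.sitesPerDir k) (EK hk z - EK hk c)) • ∑ y, J y‖
          ≤ C * (D * (8 + 192 * ((9 * n : ℕ) : ℝ)) / max 1 ((Site.tdist z c : ℕ) : ℝ))) := by
  obtain ⟨c1, hc1, K1⟩ := abs_green_EK_le
  obtain ⟨c3, hc3, K3⟩ := abs_green2_grad_EK_le
  obtain ⟨c6, hc6, K6⟩ := abs_green2_sub_zero_EK_le
  obtain ⟨Ca, hCa, CVa⟩ := conv_green_le
  obtain ⟨Cb, hCb, CVb⟩ := conv_green_grad_le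
  refine ⟨c1 + c3 + c6 + Ca + Cb, by positivity, ?_⟩
  intro P hd k hk b c n hn hc V _ _ J D hD hJ hJ0
  classical
  -- the displayed biharmonic torus Green function
  set G₂ : TorusSite P.d (P.L ^ k * P.sitesPerDir k) → ℝ := fun t =>
    (∑ q ∈ (univ : Finset (TorusSite P.d (P.L ^ k * P.sitesPerDir k))).erase 0,
      Real.cos (∑ i, latticeMomentum (P.L ^ k * P.sitesPerDir k) q i * ((t i).val : ℝ))
        / dispersion (latticeMomentum (P.L ^ k * P.sitesPerDir k) q) ^ 2)
      / (((P.L ^ k * P.sitesPerDir k : ℕ) : ℝ)) ^ P.d with hG₂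
  obtain ⟨Gf, Uf, Gs, -, -, -, -, h5, h6, h7, -⟩ := exists_green_site_split_free (P := P) (k := k) hk (c := (1 : ℝ)) one_ne_zero (V := V)
  -- bookkeeping
  set SJ : ℝ := D * (8 + 192 * ((9 * n : ℕ) : ℝ)) with hSJdef
  have hJsum : ∑ y, ‖J y‖ ≤ SJ := sum_norm_le_of_density hd b n J hD hJ hJ0
  have hSJ0 : 0 ≤ SJ := (Finset.sum_nonneg fun y _ => norm_nonneg (J y)).trans hJsum
  have hJsupp : ∀ y, J y ≠ 0 → Site.tdist y b ≤ 9 * n := fun y hy => by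
    by_contra h
    exact hy (hJ0 y (not_le.1 h))
  have hw0 : ∀ y, 45 * n < Site.tdist y b → ‖J y‖ = 0 := fun y hy => by rw [hJ0 y (by omega), norm_zero]
  have hR1 : 1 ≤ 45 * n := by omega
  -- the kernel and its two displayed formulas
  set G : Site P 0 → Site P 0 → ℝ := fun y z => Gf y z - Gf c z with hGdef
  have hGval : ∀ y z, G y z = (1 / 4 : ℝ) * (G₂ (EK hk z - EK hk y) - G₂ (EK hk z - EK hk c)) := by
    intro y z
    simp only [hGdef]
    rw [h7 G₂ (fun _ => rfl), h7 G₂ (fun _ => rfl)]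
    ring
  have hGlap : ∀ y z, laplace 1 (G y) z = (1 / 2 : ℝ) * (torusGreen (L := P.L ^ k * P.sitesPerDir k) (EK hk z - EK hk y)
      - torusGreen (L := P.L ^ k * P.sitesPerDir k) (EK hk z - EK hk c)) := by
    intro y z
    have e : G y = fun w => Gf y w - Gf c w := rfl
    rw [e, laplace_one_sub, h5, h5]
    ring
  -- the convolution rows at this density
  have CVa' : ∀ x : Site P 0, Site.tdist x b ≤ 2 * (45 * n) →
      ∑ y, |torusGreen (L := P.L ^ k * P.sitesPerDir k) (EK hk y - EK hk x)| * ‖J y‖ ≤ Ca * D * Real.sqrt (3 * ((45 * n : ℕ) : ℝ) / max 1 ((Site.tdist x b : ℕ) : ℝ)) :=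
    fun x hx => CVa P hd k hk b x (45 * n) hR1 hx (fun y => ‖J y‖) D hD (fun y => norm_nonneg _) hJ hw0
  have CVb' : ∀ (x : Site P 0) (i : Fin P.d), Site.tdist x b ≤ 2 * (45 * n) →
      ∑ y, |torusGreen (L := P.L ^ k * P.sitesPerDir k) ((EK hk y - EK hk x) + Pi.single i 1) - torusGreen (L := P.L ^ k * P.sitesPerDir k) (EK hk y - EK hk x)| * ‖J y‖
        ≤ Cb * D * (max 1 ((Site.tdist x b : ℕ) : ℝ))⁻¹ :=
    fun x i hx => CVb P hd k hk i b x (45 * n) hx (fun y => ‖J y‖) D hD (fun y => norm_nonneg _) hJ hw0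
  refine ⟨G, fun y z => bilaplace_green_rebase 1 Gf (embIter k default) c h6 y z, hGlap, hJsum, ?_, ?_,
    laplace_potential_eq_P1_sub_M1 hk c J G hGlap, laplace_P1_eq hk J, ?_, ?_, ?_⟩
  · -- (F0-0)
    intro z
    refine (norm_potential_le hk b c n J G hc hJsupp G₂ hGval hc6 hJsum (K6 P hd k hk G₂ fun _ => rfl) z).trans ?_
    exact mul_le_mul_of_nonneg_right (mul_le_mul_of_nonneg_right (by linarith) hSJ0) (by positivity)
  · -- (F0-1)
    intro z μ
    have h := norm_potential_diff_le hk c J G G₂ hGval hJsum (K3 P hd k hk G₂ fun _ => rfl) z μ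
    have a1 : c3 / 2 * SJ ≤ (c1 + c3 + c6 + Ca + Cb) * SJ := mul_le_mul_of_nonneg_right (by linarith) hSJ0
    exact ⟨h.1.trans a1, h.2.trans a1⟩
  · -- (P1-0)
    intro z hz
    refine (norm_P1_le hk b n J CVa' z hz).trans ?_
    exact mul_le_mul_of_nonneg_right (by linarith) (mul_nonneg hD (Real.sqrt_nonneg _))
  · -- (P1-1)
    intro z μ hz
    have h := norm_P1_diff_le hk b n J hn hCb hD CVb' z μ hz
    have a : Cb * (D / max 1 ((Site.tdist z b : ℕ) : ℝ)) ≤ (c1 + c3 + c6 + Ca + Cb) * (D / max 1 ((Site.tdist z b : ℕ) : ℝ)) :=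
      mul_le_mul_of_nonneg_right (by linarith) (div_nonneg hD (le_trans zero_le_one (le_max_left _ _)))
    exact ⟨h.1.trans a, h.2.trans a⟩
  · -- (M1-0)
    intro z
    refine (norm_M1_le hk c J hJsum (K1 P hd k hk) z).trans ?_
    exact mul_le_mul_of_nonneg_right (by linarith) (div_nonneg hSJ0 (le_trans zero_le_one (le_max_left _ _)))

end Summit.QuantumFields.YangMills.Theorems.Prop7TransplantGen1F0Rows
end
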